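import Literature.NumberTheory.EllipticCurves.Sprung2012.ColemanOrbitLayerTwoModPProofs
import Literature.NumberTheory.EllipticCurves.Sprung2012.ColemanOrbitSecondGeneratorProofs
import Mathlib.RingTheory.Polynomial.Cyclotomic.Eval
import HarnessLib

/-!
# Sprung 2012 — the `p²` layer functionals of a Coleman orbit are independent modulo `p` (roadmap step (R2c))

In the tree's functional model of `H¹_Iw(T)` (`Hom(E(K_∞·K_v), ℤ_p)` with the `Λ`-action `lambdaSMul` of a topological
generator, `LocalIwasawaModule.lean`) and of the joint Coleman map (`IsColemanPair`, Def. 5.9 of [Sprung2012]), let `z₀` be a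
functional whose Coleman value `(α, β) = (L♯, L♭)` has `α ∈ Λˣ` and `β(0) ∈ ℤ_pˣ` (over `ℚ` at an odd supersingular prime
such a `z₀` exists: `exists_isColemanPair_isUnit`). Restricting the orbit `T^t • z₀` to the layer `E(K_2·K_v)` gives
`p² − p + 1` functionals, and the saturation clause of a Honda system gives `p − 1` more, `y_i = (T^{p²−p+1+i} • z₀)|₂ / p`
(`exists_layer_functional_mul_eq_lambdaSMul_X_pow`). The main theorem of this file,
`natCast_dvd_of_orbit_and_second_generators`, proves that these `p²` functionals are linearly independent modulo `p`:
a relation `∑ λ_t (T^t • z₀)|₂ + ∑ μ_i y_i ≡ 0 (mod p)` forces `λ ≡ 0`, `μ ≡ 0 (mod p)`.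

PROOF (Sprung 2012, Lemma 2.3 / Def. 5.9 levels `1, 2`, with `Φ_{p²}(1) = p`): put `F = pH + T^{p²−p+1}G`
(`H = ∑ λ_t T^t`, `G = ∑ μ_i T^i`, `deg G < p − 1`). The relation says `(F • z₀)|₂ ∈ p²·Hom`, so both pairing sums of
`F • z₀` (at `c_2` and at `c_1`) lie in `p²Λ`. Level `1` of Def. 5.9 and `α ∈ Λˣ` give `F = ω_1 B − p²A`; reducing modulo `p`
(`ω_1 ≡ T^p`) yields `B ≡ T^{p²−2p+1} G` and an expression of `H` modulo `p`. Level `2` gives `ω_2 (Q + Gβ) ∈ pΛ`, hence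
`Q + Gβ ∈ pΛ` (`ω_2 ≡ T^{p²}` is not a zero divisor mod `p`); dividing the level-`2` identity by `p` and reducing modulo `p`
leaves `Ḡ₂ Ḡ T^p β̄ = T^{p²} Q̄₂ − ā′ᾱ Ḡ T^{p²−p+1} + T^{2p−1} B̄₁ β̄ + Ē₁ T^{p²−p} Ḡ β̄` with `G₂(0) = Φ_{p²}(1)/p = 1` and
`E₁(0) = 0`; comparing the coefficients of `T^{p+v}`, `v < p − 1`, by induction (`eq_zero_of_coeff_comparison`) forces
`Ḡ = 0`. Then `F = p (H + T^{p²−p+1} G″)` and the level-`2` estimate modulo `p` (`natCast_dvd_coeff_of_dvd_lambdaSMul_apply`,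
file `ColemanOrbitLayerTwoModPProofs`) gives `λ̄ = 0`.

This is the last local input of the in-tree derivation of the RANK of the Honda orbit matrix, hence of the cokernel half of
the Kurihara–Pollack sequence `0 → H¹_Iw(T) → Λ² → ℤ_p → 0` [cite: KuriharaPollack2007, Prop. 1.2] [cite: LeiSujatha2021, §3]
(assembled over `ℚ` in `ColemanMapJointCokernelOfHondaProofs`). Theorems only; §0 is private plumbing in `Λ` and `𝔽_p⟦T⟧`.

References: [cite: Sprung2012, Thm. 2.2 and Lemma 2.3 (p. 1487), Def. 5.9 (p. 1495), Def. 7.1–7.2 and Prop. 7.3 (p. 1500)]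
[cite: Sprung2017, §4 Cor. 4.4] [cite: Pollack2003, Thm. 6.17 (ω_n)].
-/

noncomputable section

open scoped Classical

open Polynomial Finset

namespace Literature.NumberTheory.EllipticCurves.Sprung2012

open Literature.NumberTheory.EllipticCurves Literature.NumberTheory.GaloisRepresentations ZpExtension
  Literature.NumberTheory.EllipticCurves.Kobayashi2003 Literature.NumberTheory.EllipticCurves.Sprung2017

/-! ## §0 Plumbing in `Λ = ℤ_p⟦T⟧` and `𝔽_p⟦T⟧` -/

section ModP

variable {p : ℕ} [Fact p.Prime]

/-- Reduction modulo `p` commutes with `ℤ[X] → Λ`. [folklore] -/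
private theorem map_toZMod_toIwasawa₃ (q : ℤ[X]) :
    PowerSeries.map (PadicInt.toZMod (p := p)) (toIwasawa p q) = ((q.map (Int.castRingHom (ZMod p)) : (ZMod p)[X]) :
      PowerSeries (ZMod p)) := by
  ext n
  rw [PowerSeries.coeff_map, show toIwasawa p q = ((q.map (Int.castRingHom ℤ_[p]) : ℤ_[p][X]) : PowerSeries ℤ_[p]) from rfl,
    Polynomial.coeff_coe, Polynomial.coeff_coe, Polynomial.coeff_map, Polynomial.coeff_map, eq_intCast, eq_intCast,
    map_intCast]

/-- `ω_n ≡ T^{pⁿ} (mod p)`. [cite: Pollack2003, Thm. 6.17 (ω_n)] -/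
private theorem map_toZMod_toIwasawa_cyclotomicOmega₃ (n : ℕ) :
    PowerSeries.map (PadicInt.toZMod (p := p)) (toIwasawa p (cyclotomicOmega p n)) = PowerSeries.X ^ p ^ n := by
  rw [map_toZMod_toIwasawa₃, cyclotomicOmega, Polynomial.map_sub, Polynomial.map_pow, Polynomial.map_add,
    Polynomial.map_X, Polynomial.map_one, add_pow_char_pow, one_pow, add_sub_cancel_right, Polynomial.coe_pow,
    Polynomial.coe_X]

/-- `Φ_p(1+T) ≡ T^{p−1} (mod p)`. [cite: Pollack2003, Thm. 6.17 (ω_n)] -/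
private theorem map_toZMod_toIwasawa_cyclotomic_comp_one₃ :
    PowerSeries.map (PadicInt.toZMod (p := p)) (toIwasawa p ((cyclotomic p ℤ).comp (X + 1))) = PowerSeries.X ^ (p - 1) := by
  have hp : p.Prime := Fact.out
  have h := congrArg (PowerSeries.map (PadicInt.toZMod (p := p))) (toIwasawa_cyclotomicOmega_one (p := p))
  rw [map_mul, map_toZMod_toIwasawa_cyclotomicOmega₃, PowerSeries.map_X, pow_one,
    show (PowerSeries.X : PowerSeries (ZMod p)) ^ p = PowerSeries.X * PowerSeries.X ^ (p - 1) by
      rw [← pow_succ', Nat.sub_add_cancel hp.one_le]] at h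
  exact (mul_left_cancel₀ PowerSeries.X_ne_zero h).symm

/-- A power series over `ℤ_p` vanishing modulo `p` is `p` times a power series. [folklore] -/
private theorem exists_eq_C_mul_of_map_toZMod_eq_zero₃ {F : IwasawaAlgebra p}
    (h : PowerSeries.map (PadicInt.toZMod (p := p)) F = 0) : ∃ G : IwasawaAlgebra p, F = PowerSeries.C (p : ℤ_[p]) * G := by
  have hc : ∀ n, (p : ℤ_[p]) ∣ PowerSeries.coeff n F := fun n ↦ by
    have hn := congrArg (PowerSeries.coeff n) h
    rw [PowerSeries.coeff_map, map_zero] at hn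
    rwa [← RingHom.mem_ker, PadicInt.ker_toZMod, PadicInt.maximalIdeal_eq_span_p, Ideal.mem_span_singleton] at hn
  choose g hg using hc
  exact ⟨PowerSeries.mk g, PowerSeries.ext fun n ↦ by rw [PowerSeries.coeff_C_mul, PowerSeries.coeff_mk, hg n]⟩

/-- `ω_2 · Y ∈ p·Λ ⟹ Y ∈ p·Λ` (`ω_2` is primitive). [folklore] -/
private theorem exists_eq_C_mul_of_omega_mul_eq {Y Z : IwasawaAlgebra p}
    (h : toIwasawa p (cyclotomicOmega p 2) * Y = PowerSeries.C (p : ℤ_[p]) * Z) :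
    ∃ Y' : IwasawaAlgebra p, Y = PowerSeries.C (p : ℤ_[p]) * Y' := by
  refine exists_eq_C_mul_of_map_toZMod_eq_zero₃ ?_
  have h' := congrArg (PowerSeries.map (PadicInt.toZMod (p := p))) h
  rw [map_mul, map_toZMod_toIwasawa_cyclotomicOmega₃, map_mul, PowerSeries.map_C, map_natCast, ZMod.natCast_self, map_zero,
    zero_mul] at h'
  exact (mul_eq_zero.mp h').resolve_left (pow_ne_zero _ PowerSeries.X_ne_zero)

/-- `Φ_{p²}(1) = p`: the constant coefficient of `Φ_{p²}(1+T)` in `Λ`. [folklore] -/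
private theorem constantCoeff_toIwasawa_cyclotomic_sq_comp :
    PowerSeries.constantCoeff (toIwasawa p ((cyclotomic (p ^ 2) ℤ).comp (X + 1))) = (p : ℤ_[p]) := by
  rw [show toIwasawa p ((cyclotomic (p ^ 2) ℤ).comp (X + 1)) =
      ((((cyclotomic (p ^ 2) ℤ).comp (X + 1)).map (Int.castRingHom ℤ_[p]) : ℤ_[p][X]) : PowerSeries ℤ_[p]) from rfl,
    Polynomial.constantCoeff_coe, Polynomial.coeff_map, Polynomial.coeff_zero_eq_eval_zero, eval_comp, eval_add, eval_X,
    eval_one, zero_add, show (cyclotomic (p ^ 2) ℤ) = cyclotomic (p ^ (1 + 1)) ℤ by norm_num, eval_one_cyclotomic_prime_pow,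
    eq_intCast, Int.cast_natCast]

/-- **The coefficient comparison (core of (R2c)), over `𝔽_p`.** Suppose power series over a field satisfy
`a·X^{m+1}·G − X^{p−1}·(X·E·X^{m+1−p}·G + X^p·B)·b + G₂·X^p·G·b = X^{n}·Q` with `G₂(0) = 1`, `b(0) ≠ 0`, `G` a polynomial of
degree `< p − 1`, and `2p − 2 < m + 1`, `2p − 2 < n`, `p ≤ m + 1`. Then `G = 0`: comparing coefficients of `X^{p+v}` by induction
on `v`, only the term `G₂·X^p·G·b` contributes, with coefficient `G_v·b(0)`. [folklore] -/
private theorem eq_zero_of_coeff_comparison {R : Type*} [Field R] {p m n : ℕ} (hp : 1 ≤ p) (hm : 2 * p - 2 < m + 1)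
    (hn : 2 * p - 2 < n) (hpm : p ≤ m + 1) {a G E B b G₂ Q : PowerSeries R}
    (hG : ∀ i, p - 1 ≤ i → PowerSeries.coeff i G = 0) (hG₂ : PowerSeries.constantCoeff G₂ = 1)
    (hb : PowerSeries.constantCoeff b ≠ 0)
    (h : a * PowerSeries.X ^ (m + 1) * G -
        PowerSeries.X ^ (p - 1) * (PowerSeries.X * E * PowerSeries.X ^ (m + 1 - p) * G + PowerSeries.X ^ p * B) * b +
        G₂ * PowerSeries.X ^ p * G * b = PowerSeries.X ^ n * Q) :
    G = 0 := by
  -- every coefficient vanishes, by strong induction on the index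
  suffices hall : ∀ v, PowerSeries.coeff v G = 0 by
    ext v; rw [hall v, map_zero]
  intro v
  induction v using Nat.strong_induction_on with
  | _ v ih =>
    by_cases hv : p - 1 ≤ v
    · exact hG v hv
    push Not at hv
    -- compare the coefficients of `X^{p+v}`
    have hc := congrArg (PowerSeries.coeff (p + v)) h
    -- rewrite the four terms as `X^N * (...)`
    have e1 : a * PowerSeries.X ^ (m + 1) * G = PowerSeries.X ^ (m + 1) * (a * G) := by ring
    have e2 : PowerSeries.X ^ (p - 1) * (PowerSeries.X * E * PowerSeries.X ^ (m + 1 - p) * G + PowerSeries.X ^ p * B) * b =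
        PowerSeries.X ^ (m + 1) * (E * G * b) + PowerSeries.X ^ (2 * p - 1) * (B * b) := by
      have : p - 1 + 1 + (m + 1 - p) = m + 1 := by omega
      have h2 : p - 1 + p = 2 * p - 1 := by omega
      rw [mul_add, add_mul, show PowerSeries.X ^ (p - 1) * (PowerSeries.X * E * PowerSeries.X ^ (m + 1 - p) * G) * b =
        PowerSeries.X ^ (p - 1 + 1 + (m + 1 - p)) * (E * G * b) by rw [pow_add, pow_add, pow_one]; ring, this,
        show PowerSeries.X ^ (p - 1) * (PowerSeries.X ^ p * B) * b = PowerSeries.X ^ (p - 1 + p) * (B * b) by rw [pow_add]; ring, h2]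
    have e3 : G₂ * PowerSeries.X ^ p * G * b = PowerSeries.X ^ p * (G * (G₂ * b)) := by ring
    rw [e1, e2, e3, map_add, map_sub, map_add, PowerSeries.coeff_X_pow_mul', if_neg (by omega), PowerSeries.coeff_X_pow_mul',
      if_neg (by omega), PowerSeries.coeff_X_pow_mul', if_neg (by omega), PowerSeries.coeff_X_pow_mul', if_pos (by omega),
      PowerSeries.coeff_X_pow_mul', if_neg (by omega), zero_sub, zero_add, neg_zero, zero_add,
      show p + v - p = v by omega, PowerSeries.coeff_mul] at hc
    -- the coefficient of `X^v` in `G * (G₂ b)` is `G_v · G₂(0) b(0)`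
    rw [Finset.Nat.sum_antidiagonal_eq_sum_range_succ (fun i j ↦ PowerSeries.coeff i G * PowerSeries.coeff j (G₂ * b)) v,
      sum_range_succ, sum_eq_zero (fun i hi ↦ by rw [ih i (mem_range.mp hi), zero_mul]), zero_add, Nat.sub_self,
      PowerSeries.coeff_zero_eq_constantCoeff, map_mul, hG₂, one_mul] at hc
    exact (mul_eq_zero.mp hc).resolve_right hb

end ModP

/-! ## §1 The independence modulo `p` of the `p²` layer functionals -/

section Local

universe u

variable {K : Type u} [Field K] {p : ℕ} [Fact p.Prime] (κ : ZpExtension K p)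
variable {E : Type u} [Field E] [Algebra K E] (ι : AlgebraicClosure K →ₐ[K] AlgebraicClosure E)
variable (W : WeierstrassCurve K)

variable {κ ι W}

/-- `Λ`-linearity of `lambdaSMul` over finite sums (plumbing). [cite: Sprung2012, Def. 5.9 (p. 1495)] -/
private theorem lambdaSMul_finset_sum' {g : Field.absoluteGaloisGroup E} (hg : κ.IsTopGenerator (resGalOfEmb ι g))
    {ι' : Type*} (s : Finset ι') (F : ι' → IwasawaAlgebra p) (z : localTowerPointsOfEmb κ ι W →+ ℤ_[p]) :
    lambdaSMul κ ι W hg (∑ t ∈ s, F t) z = ∑ t ∈ s, lambdaSMul κ ι W hg (F t) z := by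
  induction s using Finset.induction_on with
  | empty => rw [sum_empty, sum_empty, zero_lambdaSMul]
  | insert a s ha ih => rw [sum_insert ha, sum_insert ha, add_lambdaSMul, ih]

/-- `(C a · f) • z = a · (f • z)` pointwise (plumbing). [cite: Sprung2012, Def. 5.9 (p. 1495)] -/
private theorem lambdaSMul_C_mul_apply {g : Field.absoluteGaloisGroup E} (hg : κ.IsTopGenerator (resGalOfEmb ι g))
    (a : ℤ_[p]) (f : IwasawaAlgebra p) (z : localTowerPointsOfEmb κ ι W →+ ℤ_[p]) (x : localPoints W E)
    (hx : x ∈ localTowerPointsOfEmb κ ι W) :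
    lambdaSMul κ ι W hg (PowerSeries.C a * f) z ⟨x, hx⟩ = a * lambdaSMul κ ι W hg f z ⟨x, hx⟩ := by
  rw [mul_lambdaSMul, lambdaSMul_C, AddMonoidHom.smul_apply, smul_eq_mul]

/-- **(R2c) The `p²` layer functionals are independent modulo `p`.** For `z₀` with Coleman value `(α, β)`, `α ∈ Λˣ`,
`β(0) ∈ ℤ_p^×` (`p ∣ a_p`, Honda levels), `G₂, E₁` with `Φ_{p²}(1+T) = T^{p²−p} + pG₂`, `ω_1 = T^p + pE₁`, and layer functionals
`y_i` with `p·y_i = (T^{p²−p+1+i} • z₀)|₂` (`i < p − 1`; they exist by `exists_layer_functional_mul_eq_lambdaSMul_X_pow`):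
if `∑_{t<p²−p+1} λ_t (T^t • z₀)|₂ + ∑_{i<p−1} μ_i y_i ≡ 0 (mod p)` pointwise on `E(K_2·K_v)`, then all `λ_t, μ_i ≡ 0 (mod p)`.
PROOF: `F := pH + T^{p²−p+1}G` (`H = ∑ λ_tT^t`, `G = ∑ μ_iT^i`) has `(F•z₀)|₂ ≡ 0 (mod p²)`, so its pairing sums at `c_2, c_1`
are in `p²Λ`; level `1` of Def. 5.9 and `α ∈ Λˣ` give `F = ω_1B − p²A`, whence `B ≡ T^{p²−2p+1}G` and
`H ≡ E₁T^{p²−2p+1}G + T^pB₁ (mod p)`; level `2` gives `ω_2(Q + Gβ) ∈ pΛ`, so after dividing by `p` and reducing mod `p`: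
`Ḡ₂ḠT^pβ̄ = T^{p²}Q̄₂ − ā′ᾱḠT^{p²−p+1} + T^{2p−1}B̄₁β̄ + Ē₁T^{p²−p}Ḡβ̄` with `G₂(0) = Φ_{p²}(1)/p = 1`, `E₁(0) = 0`;
`eq_zero_of_coeff_comparison` forces `Ḡ = 0`; then `F = p(H + T^{p²−p+1}G″)` and `natCast_dvd_coeff_of_dvd_lambdaSMul_apply`
gives `λ̄ = 0`. [cite: Sprung2012, Thm. 2.2 and Lemma 2.3 (p. 1487), Def. 5.9 (p. 1495), Def. 7.1–7.2 (p. 1500)] [cite: Sprung2017, §4 Cor. 4.4] -/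
theorem natCast_dvd_of_orbit_and_second_generators {ap : ℤ} (hap : (p : ℤ) ∣ ap) {g : Field.absoluteGaloisGroup E}
    (hg : κ.IsTopGenerator (resGalOfEmb ι g)) {c : ℕ → localPoints W E} (hc : ∀ n, c n ∈ localLayerPointsOfEmb κ ι W n)
    {z₀ : localTowerPointsOfEmb κ ι W →+ ℤ_[p]} {α β : IwasawaAlgebra p} (h₀ : IsColemanPair κ ι W ap g c z₀ α β)
    (hα : IsUnit α) (hβ : IsUnit (PowerSeries.constantCoeff β)) {G₂ E₁ : IwasawaAlgebra p}
    (hG₂ : toIwasawa p ((cyclotomic (p ^ 2) ℤ).comp (X + 1)) = PowerSeries.X ^ (p ^ 2 - p) + PowerSeries.C (p : ℤ_[p]) * G₂)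
    (hE₁ : toIwasawa p (cyclotomicOmega p 1) = PowerSeries.X ^ p + PowerSeries.C (p : ℤ_[p]) * E₁)
    (y : Fin (p - 1) → (localLayerPointsOfEmb κ ι W 2 →+ ℤ_[p]))
    (hy : ∀ (i : Fin (p - 1)) (x : localPoints W E) (hx : x ∈ localLayerPointsOfEmb κ ι W 2),
      lambdaSMul κ ι W hg ((PowerSeries.X : IwasawaAlgebra p) ^ (p ^ 2 - p + 1 + i)) z₀
        ⟨x, localLayerPointsOfEmb_le_localTowerPointsOfEmb κ ι W 2 hx⟩ = (p : ℤ_[p]) * y i ⟨x, hx⟩)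
    (lam : Fin (p ^ 2 - p + 1) → ℤ_[p]) (mu : Fin (p - 1) → ℤ_[p])
    (hrel : ∀ (x : localPoints W E) (hx : x ∈ localLayerPointsOfEmb κ ι W 2),
      (p : ℤ_[p]) ∣ (∑ t, lam t * lambdaSMul κ ι W hg ((PowerSeries.X : IwasawaAlgebra p) ^ (t : ℕ)) z₀
        ⟨x, localLayerPointsOfEmb_le_localTowerPointsOfEmb κ ι W 2 hx⟩) + ∑ i, mu i * y i ⟨x, hx⟩) :
    (∀ t, (p : ℤ_[p]) ∣ lam t) ∧ (∀ i, (p : ℤ_[p]) ∣ mu i) := by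
  have hp : p.Prime := Fact.out
  have hp1 : 1 ≤ p := hp.one_le
  have h2p : 2 * p ≤ p ^ 2 := by rw [sq]; exact Nat.mul_le_mul_right p hp.two_le
  have hc' : p ^ 2 - p = p * (p - 1) := by rw [sq, Nat.mul_sub_one]
  have hc2 : 2 * (p - 1) ≤ p ^ 2 - p := by rw [hc']; exact Nat.mul_le_mul_right _ hp.two_le
  have hq : p ^ 2 - p + p = p ^ 2 := Nat.sub_add_cancel (le_trans (by omega) h2p)
  have hpm : p ≤ p ^ 2 - p + 1 := by generalize p ^ 2 - p = cc at hc2 ⊢; omega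
  have hm2 : 2 * p - 2 < p ^ 2 - p + 1 := by generalize p ^ 2 - p = cc at hc2 ⊢; omega
  have hn2 : 2 * p - 2 < p ^ 2 := by generalize p ^ 2 - p = cc at hc2 hq ⊢; omega
  have hle := fun n ↦ localLayerPointsOfEmb_le_localTowerPointsOfEmb κ ι W n
  -- names
  set Φ₁ : IwasawaAlgebra p := toIwasawa p ((cyclotomic p ℤ).comp (X + 1)) with hΦ₁
  set Φ₂ : IwasawaAlgebra p := toIwasawa p ((cyclotomic (p ^ 2) ℤ).comp (X + 1)) with hΦ₂
  set ω₁ : IwasawaAlgebra p := toIwasawa p (cyclotomicOmega p 1) with hω₁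
  set ω₂ : IwasawaAlgebra p := toIwasawa p (cyclotomicOmega p 2) with hω₂
  have eω₁ : ω₁ = PowerSeries.X * Φ₁ := toIwasawa_cyclotomicOmega_one
  have eω₂ : ω₂ = ω₁ * Φ₂ := by
    rw [hω₂, hω₁, hΦ₂, ← map_mul, show (2 : ℕ) = 1 + 1 from rfl, cyclotomicOmega_succ]
  set Cp : IwasawaAlgebra p := PowerSeries.C (p : ℤ_[p]) with hCp
  have hp0 : (p : ℤ_[p]) ≠ 0 := Nat.cast_ne_zero.mpr hp.ne_zero
  have hCp0 : Cp ≠ 0 := by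
    intro h
    have := congrArg PowerSeries.constantCoeff h
    rw [hCp, PowerSeries.constantCoeff_C, map_zero] at this
    exact hp0 this
  obtain ⟨a', rfl⟩ := hap
  obtain ⟨u, hu⟩ := hα
  -- the polynomials `H`, `G` and `F = p·H + T^{m+1}·G`
  set H : IwasawaAlgebra p := ∑ t : Fin (p ^ 2 - p + 1), PowerSeries.C (lam t) * PowerSeries.X ^ (t : ℕ) with hH
  set G : IwasawaAlgebra p := ∑ i : Fin (p - 1), PowerSeries.C (mu i) * PowerSeries.X ^ (i : ℕ) with hG
  set F : IwasawaAlgebra p := Cp * H + PowerSeries.X ^ (p ^ 2 - p + 1) * G with hF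
  -- (S1) the values of `F • z₀` on the layer are divisible by `p²`
  have hFval : ∀ (x : localPoints W E) (hx : x ∈ localLayerPointsOfEmb κ ι W 2), ∃ w : ℤ_[p],
      lambdaSMul κ ι W hg F z₀ ⟨x, hle 2 hx⟩ = (p : ℤ_[p]) * ((p : ℤ_[p]) * w) := by
    intro x hx
    obtain ⟨w, hw⟩ := hrel x hx
    refine ⟨w, ?_⟩
    have hXG : PowerSeries.X ^ (p ^ 2 - p + 1) * G =
        ∑ i : Fin (p - 1), PowerSeries.C (mu i) * PowerSeries.X ^ (p ^ 2 - p + 1 + (i : ℕ)) := by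
      rw [hG, mul_sum]
      exact sum_congr rfl fun i _ ↦ by rw [pow_add]; ring
    have e1 : ∑ t : Fin (p ^ 2 - p + 1), lambdaSMul κ ι W hg (PowerSeries.C (lam t) * PowerSeries.X ^ (t : ℕ)) z₀ ⟨x, hle 2 hx⟩ =
        ∑ t, lam t * lambdaSMul κ ι W hg ((PowerSeries.X : IwasawaAlgebra p) ^ (t : ℕ)) z₀ ⟨x, hle 2 hx⟩ :=
      sum_congr rfl fun t _ ↦ lambdaSMul_C_mul_apply hg _ _ _ _ _
    have e2 : ∑ i : Fin (p - 1), lambdaSMul κ ι W hg (PowerSeries.C (mu i) * PowerSeries.X ^ (p ^ 2 - p + 1 + (i : ℕ))) z₀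
        ⟨x, hle 2 hx⟩ = (p : ℤ_[p]) * ∑ i, mu i * y i ⟨x, hx⟩ := by
      rw [mul_sum]
      exact sum_congr rfl fun i _ ↦ by rw [lambdaSMul_C_mul_apply, hy i x hx]; ring
    rw [← hw, hF, hXG, add_lambdaSMul, AddMonoidHom.add_apply, hCp, lambdaSMul_C_mul_apply, hH, lambdaSMul_finset_sum',
      AddMonoidHom.finsetSum_apply, lambdaSMul_finset_sum', AddMonoidHom.finsetSum_apply, e1, e2]
    ring
  -- (S2) pairing sums of `F • z₀` at layer points are in `p²Λ`
  have hpair : ∀ (n : ℕ) {x₀ : localPoints W E}, x₀ ∈ localLayerPointsOfEmb κ ι W 2 → ∃ A' : IwasawaAlgebra p,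
      pairingSum W (localTowerPointsOfEmb κ ι W) g n x₀ (lambdaSMul κ ι W hg F z₀) = Cp * Cp * A' := by
    intro n x₀ hx₀
    have hj : ∀ j : ℕ, g ^ j • x₀ ∈ localLayerPointsOfEmb κ ι W 2 := fun j ↦ smul_mem_localLayerPointsOfEmb κ ι W 2 _ hx₀
    choose w hw using fun j : ℕ ↦ hFval (g ^ j • x₀) (hj j)
    refine ⟨∑ j ∈ range (p ^ n), PowerSeries.C (w j) * (1 + PowerSeries.X) ^ j, ?_⟩
    rw [pairingSum_def, mul_sum]
    refine sum_congr rfl fun j _ ↦ ?_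
    rw [evalOn_of_mem W _ _ (hle 2 (hj j)), hw j, map_mul, map_mul, hCp]
    ring
  obtain ⟨A₂, hA₂⟩ := hpair 2 (hc 2)
  obtain ⟨A₁, hA₁⟩ := hpair 1 (localLayerPointsOfEmb_mono κ ι W (by norm_num : 1 ≤ 2) (hc 1))
  -- (S3) the Coleman data of `F • z₀`
  have hFz := isColemanPair_lambdaSMul hg hc h₀ F
  obtain ⟨Q', hQ'⟩ := hFz 1
  rw [sharpPoly_one, flatPoly_one, map_one, map_zero, one_mul, zero_mul, add_zero, hA₁, ← hω₁] at hQ'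
  obtain ⟨Q, hQ⟩ := hFz 2
  rw [sharpPoly_two, flatPoly_two, pow_one, map_neg, ← hΦ₁, hA₂, ← hω₂,
    show toIwasawa p (C (↑p * a')) = Cp * PowerSeries.C (a' : ℤ_[p]) by
      rw [show toIwasawa p (C (↑p * a')) = (((C (↑p * a') : ℤ[X]).map (Int.castRingHom ℤ_[p]) : ℤ_[p][X]) : PowerSeries ℤ_[p])
        from rfl, Polynomial.map_C, eq_intCast, Polynomial.coe_C, Int.cast_mul, Int.cast_natCast, map_mul, hCp]] at hQ
  -- (S4) `α ∈ Λˣ`: `F = ω₁·B − p²·A`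
  set B : IwasawaAlgebra p := Q' * ↑u⁻¹ with hB
  set A : IwasawaAlgebra p := A₁ * ↑u⁻¹ with hA
  have hFα : F * α = ω₁ * Q' - Cp * Cp * A₁ := by linear_combination hQ'
  have hE1 : F = ω₁ * B - Cp * Cp * A := by
    calc F = F * α * ↑u⁻¹ := by rw [← hu, mul_assoc, Units.mul_inv, mul_one]
      _ = ω₁ * B - Cp * Cp * A := by rw [hFα, hB, hA]; ring
  -- (S5) reduction modulo `p`: `B ≡ T^{m+1−p}·G`, hence the expression (E2) of `H`
  have hredCp : PowerSeries.map (PadicInt.toZMod (p := p)) Cp = 0 := by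
    rw [hCp, PowerSeries.map_C, map_natCast, ZMod.natCast_self, map_zero]
  have hredω₁ : PowerSeries.map (PadicInt.toZMod (p := p)) ω₁ = PowerSeries.X ^ p := by
    rw [hω₁, map_toZMod_toIwasawa_cyclotomicOmega₃, pow_one]
  have hredω₂ : PowerSeries.map (PadicInt.toZMod (p := p)) ω₂ = PowerSeries.X ^ p ^ 2 := by
    rw [hω₂, map_toZMod_toIwasawa_cyclotomicOmega₃]
  have hredΦ₁ : PowerSeries.map (PadicInt.toZMod (p := p)) Φ₁ = PowerSeries.X ^ (p - 1) := by
    rw [hΦ₁, map_toZMod_toIwasawa_cyclotomic_comp_one₃]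
  have hredF : PowerSeries.map (PadicInt.toZMod (p := p)) F = PowerSeries.X ^ (p ^ 2 - p + 1) * PowerSeries.map PadicInt.toZMod G := by
    rw [hF, map_add, map_mul, map_mul, hredCp, zero_mul, zero_add, map_pow, PowerSeries.map_X]
  have hXm : (PowerSeries.X : IwasawaAlgebra p) ^ (p ^ 2 - p + 1) = PowerSeries.X ^ p * PowerSeries.X ^ (p ^ 2 - p + 1 - p) := by
    rw [← pow_add, Nat.add_sub_cancel' hpm]
  obtain ⟨B₁, hB₁⟩ : ∃ B₁ : IwasawaAlgebra p, B - PowerSeries.X ^ (p ^ 2 - p + 1 - p) * G = Cp * B₁ := by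
    refine exists_eq_C_mul_of_map_toZMod_eq_zero₃ ?_
    have h := congrArg (PowerSeries.map (PadicInt.toZMod (p := p))) hE1
    simp only [hredF, map_sub, map_mul, hredCp, zero_mul, sub_zero, hredω₁] at h
    have hBbar : PowerSeries.map (PadicInt.toZMod (p := p)) B =
        PowerSeries.X ^ (p ^ 2 - p + 1 - p) * PowerSeries.map PadicInt.toZMod G :=
      mul_left_cancel₀ (pow_ne_zero p PowerSeries.X_ne_zero) (by rw [← h, ← mul_assoc, ← pow_add, Nat.add_sub_cancel' hpm])
    rw [map_sub, hBbar, map_mul, map_pow, PowerSeries.map_X, sub_self]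
  have hBeq : B = PowerSeries.X ^ (p ^ 2 - p + 1 - p) * G + Cp * B₁ := by linear_combination hB₁
  have hE2 : H = E₁ * PowerSeries.X ^ (p ^ 2 - p + 1 - p) * G + PowerSeries.X ^ p * B₁ + Cp * (E₁ * B₁ - A) := by
    apply mul_left_cancel₀ hCp0
    linear_combination hE1 - hF - G * hXm + (PowerSeries.X ^ p + Cp * E₁) * hBeq + B * hE₁
  -- (S6) level `2`: `ω₂·(Q + Gβ) ∈ pΛ`, then (E3)
  have hZ : ω₂ * (Q + G * β) = Cp * (Cp * A₂ + PowerSeries.C (a' : ℤ_[p]) * F * α - Φ₁ * H * β + G₂ * ω₁ * G * β) := by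
    linear_combination (-1 : IwasawaAlgebra p) * hQ + (PowerSeries.X ^ (p ^ 2 - p) * G * β) * eω₁ - (Φ₁ * β) * hF +
      (ω₁ * G * β) * hG₂ + (G * β) * eω₂
  obtain ⟨Q₂, hQ₂⟩ := exists_eq_C_mul_of_omega_mul_eq (p := p) (Y := Q + G * β) (Z := _) (by rw [← hω₂, ← hCp]; exact hZ)
  rw [← hCp] at hQ₂
  have hE3 : Cp * A₂ + PowerSeries.C (a' : ℤ_[p]) * F * α - Φ₁ * H * β + G₂ * ω₁ * G * β = ω₂ * Q₂ := by
    apply mul_left_cancel₀ hCp0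
    rw [← hZ, hQ₂]
    ring
  -- (S7) constants: `E₁(0) = 0`, `G₂(0) = 1`, `β̄(0) ≠ 0`
  have hE₁0 : PowerSeries.constantCoeff E₁ = 0 := by
    have h := congrArg PowerSeries.constantCoeff hE₁
    rw [hω₁, constantCoeff_toIwasawa_cyclotomicOmega, map_add, map_pow, PowerSeries.constantCoeff_X, zero_pow hp.ne_zero,
      zero_add, map_mul, hCp, PowerSeries.constantCoeff_C] at h
    exact (mul_eq_zero.mp h.symm).resolve_left hp0
  obtain ⟨E', hE'⟩ : PowerSeries.X ∣ PowerSeries.map (PadicInt.toZMod (p := p)) E₁ := by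
    rw [PowerSeries.X_dvd_iff, ← PowerSeries.coeff_zero_eq_constantCoeff_apply, PowerSeries.coeff_map,
      PowerSeries.coeff_zero_eq_constantCoeff_apply, hE₁0, map_zero]
  have hG₂1 : PowerSeries.constantCoeff (PowerSeries.map (PadicInt.toZMod (p := p)) G₂) = 1 := by
    have h := congrArg PowerSeries.constantCoeff hG₂
    rw [hΦ₂, constantCoeff_toIwasawa_cyclotomic_sq_comp, map_add, map_pow, PowerSeries.constantCoeff_X,
      zero_pow (by omega : p ^ 2 - p ≠ 0), zero_add, map_mul, hCp, PowerSeries.constantCoeff_C] at h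
    have h1 : PowerSeries.constantCoeff G₂ = 1 := by
      have : (p : ℤ_[p]) * PowerSeries.constantCoeff G₂ = (p : ℤ_[p]) * 1 := by rw [mul_one]; exact h.symm
      exact mul_left_cancel₀ hp0 this
    rw [← PowerSeries.coeff_zero_eq_constantCoeff_apply, PowerSeries.coeff_map, PowerSeries.coeff_zero_eq_constantCoeff_apply, h1,
      map_one]
  have hb0 : PowerSeries.constantCoeff (PowerSeries.map (PadicInt.toZMod (p := p)) β) ≠ 0 := by
    rw [← PowerSeries.coeff_zero_eq_constantCoeff_apply, PowerSeries.coeff_map, PowerSeries.coeff_zero_eq_constantCoeff_apply]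
    exact (hβ.map _).ne_zero
  -- `Ḡ` is a polynomial of degree `< p − 1` with coefficients `μ̄_i`
  have hGcoeff : ∀ i : ℕ, PowerSeries.coeff i G = if h : i < p - 1 then mu ⟨i, h⟩ else 0 := by
    intro i
    rw [hG, map_sum]
    split_ifs with hi
    · rw [sum_eq_single ⟨i, hi⟩]
      · rw [PowerSeries.coeff_C_mul_X_pow, if_pos rfl]
      · intro s _ hs
        rw [PowerSeries.coeff_C_mul_X_pow, if_neg (fun h ↦ hs (Fin.ext h.symm))]
      · intro h; exact absurd (mem_univ _) h
    · refine sum_eq_zero fun s _ ↦ ?_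
      rw [PowerSeries.coeff_C_mul_X_pow]
      split_ifs with h
      · exact absurd (h ▸ s.2) hi
      · rfl
  -- (S8) the coefficient comparison: `Ḡ = 0`
  have hGbar : PowerSeries.map (PadicInt.toZMod (p := p)) G = 0 := by
    have h4 := congrArg (PowerSeries.map (PadicInt.toZMod (p := p))) hE3
    have hredH : PowerSeries.map (PadicInt.toZMod (p := p)) H =
        PowerSeries.map PadicInt.toZMod E₁ * PowerSeries.X ^ (p ^ 2 - p + 1 - p) * PowerSeries.map PadicInt.toZMod G +
          PowerSeries.X ^ p * PowerSeries.map PadicInt.toZMod B₁ := by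
      rw [hE2, map_add, map_add, map_mul, map_mul, map_mul, map_mul, hredCp, zero_mul, add_zero, map_pow, map_pow,
        PowerSeries.map_X]
    rw [map_add, map_sub, map_add, map_mul, hredCp, zero_mul, zero_add, map_mul, map_mul, PowerSeries.map_C, hredF,
      map_mul, map_mul, hredΦ₁, hredH, map_mul, map_mul, map_mul, hredω₁, map_mul, hredω₂, hE'] at h4
    refine eq_zero_of_coeff_comparison (R := ZMod p) hp1 hm2 hn2 hpm (a := PowerSeries.C (PadicInt.toZMod (a' : ℤ_[p])) *
      PowerSeries.map PadicInt.toZMod α) (E := E') (B := PowerSeries.map PadicInt.toZMod B₁)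
      (b := PowerSeries.map PadicInt.toZMod β) (G₂ := PowerSeries.map PadicInt.toZMod G₂)
      (Q := PowerSeries.map PadicInt.toZMod Q₂) (fun i hi ↦ ?_) hG₂1 hb0 ?_
    · rw [PowerSeries.coeff_map, hGcoeff, dif_neg (by omega), map_zero]
    · linear_combination h4
  -- hence `p ∣ μ_i`
  have hmu : ∀ i, (p : ℤ_[p]) ∣ mu i := by
    intro i
    have h := congrArg (PowerSeries.coeff (i : ℕ)) hGbar
    rw [PowerSeries.coeff_map, hGcoeff, dif_pos i.2, map_zero] at h
    rw [← RingHom.mem_ker, PadicInt.ker_toZMod, PadicInt.maximalIdeal_eq_span_p, Ideal.mem_span_singleton] at h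
    exact h
  refine ⟨fun t ↦ ?_, hmu⟩
  -- (S9) `G = p·G″`, `F = p·(H + T^{m+1}G″)`, and (R2a)
  obtain ⟨G'', hG''⟩ := exists_eq_C_mul_of_map_toZMod_eq_zero₃ hGbar
  rw [← hCp] at hG''
  have hF' : F = Cp * (H + PowerSeries.X ^ (p ^ 2 - p + 1) * G'') := by rw [hF, hG'']; ring
  have hdvd : ∀ (x : localPoints W E) (hx : x ∈ localLayerPointsOfEmb κ ι W 2),
      (p : ℤ_[p]) ∣ lambdaSMul κ ι W hg (H + PowerSeries.X ^ (p ^ 2 - p + 1) * G'') z₀ ⟨x, hle 2 hx⟩ := by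
    intro x hx
    obtain ⟨w, hw⟩ := hFval x hx
    rw [hF', hCp, lambdaSMul_C_mul_apply] at hw
    exact ⟨w, mul_left_cancel₀ hp0 hw⟩
  have h := natCast_dvd_coeff_of_dvd_lambdaSMul_apply (dvd_mul_right (p : ℤ) a') hg hc h₀ hβ
    (H + PowerSeries.X ^ (p ^ 2 - p + 1) * G'') hdvd (j := (t : ℕ)) t.2
  have hcoeff : PowerSeries.coeff (t : ℕ) (H + PowerSeries.X ^ (p ^ 2 - p + 1) * G'') = lam t := by
    rw [map_add, PowerSeries.coeff_X_pow_mul', if_neg (by have := t.2; omega), add_zero, hH, map_sum, sum_eq_single t]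
    · rw [PowerSeries.coeff_C_mul_X_pow, if_pos rfl]
    · intro s _ hs
      rw [PowerSeries.coeff_C_mul_X_pow, if_neg (fun h ↦ hs (Fin.ext h).symm)]
    · intro h; exact absurd (mem_univ t) h
  rwa [hcoeff] at h

end Local

end Literature.NumberTheory.EllipticCurves.Sprung2012

end
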